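import Summits.AnomalousDissipation.AnomalousDissipation.Theorems.SolenoidalFractalHomogenisationLagrangianStepW7ThreeModeDefs
import Literature.Analysis.FluidPDE.PassiveVectorTensorTwistedModalSymbol
import HarnessLib

/-!
# K1L_D (stmt-AnomalousDissipation-27980), (ℓ3) (D-TH)₀ «frozen-frame W7» — THREE-MODE CHAIN AT REAL WAVE VECTORS: the DEFINITIONS
# (chain right-hand sides and cross term on the fibre `ℂ³` with the Leray projection `transversalProjR q` at a REAL wave vector `q`)

Summits-side definitions file of route `SolenoidalFractalHomogenisation` (review lane; prover ad-sawtooth-k1loc-p1 g16, memo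
`HOME/ad-sawtooth-k1loc-p1/g16/DTH-costline-k1locp1g16.md` §2, finding F-p1g16-1; allocation L19 item 1 / L21 §6 «(D-TH) distorted W7 — ad-sawtooth lineage»,
RULING D28-10).  The W7 high-label decay engine (`…W7ThreeModeDefs/Form/Fibre`, `…W7SlotPointwise/SlotStep`, `…W7CellSlot`, `…W7Assembly`) runs one
hypocoercivity functional per Bloch fibre; its fibre layer `…W7ThreeModeDefs` §Fibre is written at INTEGER wave vectors `K` with the Leray projection
`Torus.transversalProj K`.  In a CONSTANT unimodular frame `G₀` (the frozen-frame / graded inputs of the (ℓ3) stage, RULING D28-3: `VmodDist.SlowVectorClauseFθg`,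
candidate `HighLabelDecayWthg`) the fibre survives with the solenoidality plane tilted to `⊥ G₀ᵀK` — the projection becomes `Torus.transversalProjR (Torus.twistFreq G₀ K)`
(ad-lit's `Literature/…/PassiveVectorTensorTwistedModalSymbol`; w1 g9's dictionary of `…CellChainDefsFrame`/`…CellChainModesFrame`).  This file is the fibre
vocabulary at an arbitrary REAL wave vector `q : Fin 3 → ℝ` — the definitions `dW0C/dWpC/dWmC/bC/xdotC` of `…W7ThreeModeDefs` VERBATIM with
`transversalProj K ↦ transversalProjR q` — so that ONE slot step serves the flat fibres (`q = K`, bridges `dW0R_intCast` … `xdotR_intCast` below, by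
`transversalProjR_intCast`) and the twisted ones (`q = twistFreq G₀ K`).
Setting (one slot, one Bloch fibre, chain modes `0, ±1, ±2`, coupling `l` frozen, phases gauged): `ẇ₀ = −y₀ + l•P₀(w₊ − w₋)`,
`ẇ₊ = −y₊ − l•(P₊w₀ − P₊w₊₊)`, `ẇ₋ = −y₋ − l•(P₋w₋₋ − P₋w₀)`, cross vector `b = l•P₀(w₊ − w₋)`, `xdot = Re⟪ẇ₀, b⟫ + Re⟪w₀, l•P₀(ẇ₊ − ẇ₋)⟫`, `P_j = transversalProjR q_j`.
Companion proof file: `…W7ThreeModeFibreR` (form inequality / equivalence / ramp pairing at real wave vectors; coercivity and upper norm bound of the TWISTED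
modal generator `4π²•P_{G₀ᵀK} T_{𝔸^{G₀}}(K)`).  Definitions + `rfl`-grade bridges only; NOT a proof of anything; K1L_D open; AD NOT proved; rung F-D1.A0.
[cite: BedrossianCotiZelati2017, §2 (hypocoercivity functional with a cross term)] [problem: turb]
-/

set_option linter.dupNamespace false

namespace Summit.AnomalousDissipation.AnomalousDissipation.Theorems.SolenoidalFractalHomogenisation.LagrangianStep.ThreeMode

open scoped InnerProductSpace

section FibreR

open Literature.Analysis.FluidPDE Literature.Analysis.FluidPDE.Torus

/-- `ẇ₀ = −y₀ + l•P₀(w₊ − w₋)` on the fibre, Leray projection at the REAL wave vector `q0`. -/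
noncomputable def dW0R (l : ℝ) (q0 : Fin 3 → ℝ) (wp wm y0 : (EuclideanSpace ℂ (Fin 3))) : (EuclideanSpace ℂ (Fin 3)) :=
  -y0 + (l : ℂ) • transversalProjR q0 (wp - wm)
/-- `ẇ₊ = −y₊ − l•(P₊w₀ − P₊w₊₊)`, Leray projection at the real wave vector `qp`. -/
noncomputable def dWpR (l : ℝ) (qp : Fin 3 → ℝ) (w0 wpp yp : (EuclideanSpace ℂ (Fin 3))) : (EuclideanSpace ℂ (Fin 3)) :=
  -yp - (l : ℂ) • (transversalProjR qp w0 - transversalProjR qp wpp)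
/-- `ẇ₋ = −y₋ − l•(P₋w₋₋ − P₋w₀)`, Leray projection at the real wave vector `qm`. -/
noncomputable def dWmR (l : ℝ) (qm : Fin 3 → ℝ) (w0 wmm ym : (EuclideanSpace ℂ (Fin 3))) : (EuclideanSpace ℂ (Fin 3)) :=
  -ym - (l : ℂ) • (transversalProjR qm wmm - transversalProjR qm w0)
/-- The cross vector `b = l•P₀(w₊ − w₋)` at the real wave vector `q0`. -/
noncomputable def bR (l : ℝ) (q0 : Fin 3 → ℝ) (wp wm : (EuclideanSpace ℂ (Fin 3))) : (EuclideanSpace ℂ (Fin 3)) :=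
  (l : ℂ) • transversalProjR q0 (wp - wm)
/-- `Ẋ` with `l` frozen: `Re⟪ẇ₀, b⟫ + Re⟪w₀, l•P₀(ẇ₊ − ẇ₋)⟫`, Leray projections at the real wave vectors `q0, qp, qm`. -/
noncomputable def xdotR (l : ℝ) (q0 qp qm : Fin 3 → ℝ) (w0 wp wm wpp wmm y0 yp ym : (EuclideanSpace ℂ (Fin 3))) : ℝ :=
  (⟪dW0R l q0 wp wm y0, bR l q0 wp wm⟫_ℂ).re
    + (⟪w0, (l : ℂ) • transversalProjR q0 (dWpR l qp w0 wpp yp - dWmR l qm w0 wmm ym)⟫_ℂ).re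

/-! ### Bridges to the integer-wave-vector definitions of `…W7ThreeModeDefs` (`q = K : ℤ³`) -/

/-- At an integer wave vector the real-wave-vector chain right-hand side is the one of `…W7ThreeModeDefs`: `dW0R l ↑K = dW0C l K`. -/
theorem dW0R_intCast (l : ℝ) (K0 : Fin 3 → ℤ) (wp wm y0 : (EuclideanSpace ℂ (Fin 3))) :
    dW0R l (fun j => (K0 j : ℝ)) wp wm y0 = dW0C l K0 wp wm y0 := by
  rw [dW0R, dW0C, transversalProjR_intCast]

/-- `dWpR l ↑K = dWpC l K`. -/
theorem dWpR_intCast (l : ℝ) (Kp : Fin 3 → ℤ) (w0 wpp yp : (EuclideanSpace ℂ (Fin 3))) :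
    dWpR l (fun j => (Kp j : ℝ)) w0 wpp yp = dWpC l Kp w0 wpp yp := by
  rw [dWpR, dWpC, transversalProjR_intCast]

/-- `dWmR l ↑K = dWmC l K`. -/
theorem dWmR_intCast (l : ℝ) (Km : Fin 3 → ℤ) (w0 wmm ym : (EuclideanSpace ℂ (Fin 3))) :
    dWmR l (fun j => (Km j : ℝ)) w0 wmm ym = dWmC l Km w0 wmm ym := by
  rw [dWmR, dWmC, transversalProjR_intCast]

/-- `bR l ↑K = bC l K`. -/
theorem bR_intCast (l : ℝ) (K0 : Fin 3 → ℤ) (wp wm : (EuclideanSpace ℂ (Fin 3))) :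
    bR l (fun j => (K0 j : ℝ)) wp wm = bC l K0 wp wm := by
  rw [bR, bC, transversalProjR_intCast]

/-- `xdotR l ↑K₀ ↑K₊ ↑K₋ = xdotC l K₀ K₊ K₋`. -/
theorem xdotR_intCast (l : ℝ) (K0 Kp Km : Fin 3 → ℤ) (w0 wp wm wpp wmm y0 yp ym : (EuclideanSpace ℂ (Fin 3))) :
    xdotR l (fun j => (K0 j : ℝ)) (fun j => (Kp j : ℝ)) (fun j => (Km j : ℝ)) w0 wp wm wpp wmm y0 yp ym
      = xdotC l K0 Kp Km w0 wp wm wpp wmm y0 yp ym := by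
  rw [xdotR, xdotC, dW0R_intCast, bR_intCast, dWpR_intCast, dWmR_intCast, transversalProjR_intCast]

end FibreR

end Summit.AnomalousDissipation.AnomalousDissipation.Theorems.SolenoidalFractalHomogenisation.LagrangianStep.ThreeMode
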